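import Summits.AtomisticToContinuum.Crystallization.Theorems.ChartedPlanarOrderDoorLayered

/-!
# PS_LJ «ProfileSlavingLJ» TYPED over tree names, with W as an explicit hypothesis (decomp-a2c lens-3 g22; critic row 413 (2))

PS column of record (row 413 (2)): `PS_LJ ⟸ D1 balance ∧ D2 windows ∧ E1 ℓ¹-range kernel ∧ W window monotonicity`.
This module types every piece over TREE names (`Layered`, `IsSep`, `IsClean`, `IsNash`, `μS`, `lennardJones`' explicit force) and PROVES the
assembly `profileSlavingLJ_of : SlavingKernelL1 → NashBalance Λ → TubeMonotone Λ η → ProfileSlavingLJ Λ η` (pure logic: the windows of the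
abstract kernel are the `η`-TUBE around the first equilibrium's increment profile, so D2 is absorbed — the PS hypothesis «increments within `η`»
puts the second profile in the tube).

THE LJ DICTIONARY (defs, junk value `0` of `tsum` wherever a lattice sum diverges — the pieces D1/W carry the summability content):
* `pairForce x = (‖x‖⁻¹⁴ − ‖x‖⁻⁸) • x` = `−∇ₓ V_LJ(‖x‖)` for `V_LJ(r) = r⁻¹²/12 − r⁻⁶/6` (tree `lennardJones`): force ON the atom at relative position `x`.
* `layerForce a b v = Σ_{(i,j) ∈ ℤ²} pairForce (v + i a + j b)`: force on one atom at offset `v` from a full layer `ℤa + ℤb`.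
* `offsetOf h k l = Σ_{i ∈ (k,l]} h i` (= `w l − w k` for `h = incr w`, `offsetOf_incr`); `gapStress a b m h = Σ_{k < m ≤ l} layerForce a b (−offsetOf h k l)`:
  the stress transmitted across gap `m` = total force per unit cell exerted by the upper half `{l ≥ m}` on the lower half `{k < m}`, as a map on
  INCREMENT profiles `h : ℤ → E3` (gap + shear + registry in one vector) — the `Φ m` of the abstract kernels (tree `…LayerChainLiouville`,
  pub `LayerChainTail.slaving_translation`).
* `IsStacked a b w`: the representation is HEIGHT-SORTED (`⟪n, w (m+1) − w m⟫ > 0` for a common normal `n ⊥ a, b`), so consecutive indices are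
  adjacent layers and each layer is ONE full coset (a finer in-plane lattice or a dense height set would violate strict monotonicity);
  `‖a‖, ‖b‖ ≤ Λ` restricts to low-index layer families — at `Λ₁ = 17/16` (recommended) exactly the nearest-neighbour-period layers
  (triangular close-packed, and square (001)-type in fcc-like regions); `Λ = 2` would admit (110)-type rectangular layers of spacing 1/2 where
  own-gap dominance `Σ_{j≠0} κ_j < λ` is doubtful — do NOT read W at `Λ = 2` without a census column.

THE PIECES (Props; tags = lens-3's estimate):
* D1 `NashBalance Λ` [S/M · TRUE?]: a clean, `δ`-separated, single-site-Nash, stacked layered LJ configuration transmits the SAME stress across every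
  gap.  Route: Nash = global single-site minimality ⇒ zero force on every atom (LJ site energy is differentiable at a separated configuration —
  the analytic half, M) ⇒ layer force balance ⇒ `gapStress (m+1) − gapStress m = −(force on layer m) = 0` (telescoping + Newton III, needs absolute
  summability of the straddling double sum: `|layerForce| ≲ height⁻⁵`, heights `≳ (l − k)/2` — S).
* W `TubeMonotone Λ η` [M/L · INSTRUMENTABLE = census TAG 138′ CHAIN + REGISTRY columns]: around every such equilibrium profile, on the `η`-tube,
  `gapStress a b m` is `λ`-strongly monotone in the own increment and `ℓ¹`-Lipschitz in all increments with summable weights `κ` of finite first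
  moment and `Σ_j κ_j − κ_0 < λ`; `λ, κ` may depend on the equilibrium (weakest form: no window-uniformity is needed for PS).  Census g13 LAT13
  (gap block, registries ideal): `(λ_mid, κ_out) = (19.95, 1.11)` at the ground states, `(5.94, 0.70)` at the weakest window corner — `2κ < λ` and
  `4κ < λ` everywhere, margin ≥ 3.1; registry (shear) stiffness per gap 1.48–25.0 > 0 on the window; shear cross-couplings not yet tabulated.
* E1 `SlavingKernelL1` [S · ATTACKABLE]: the abstract slaving kernel with `ℓ¹` couplings of finite first moment (pub `LayerChainTail.lean` §2 proves
  the finite-range case `slaving_translation`; the first moment `Σ |j| κ_j` replaces `R·Σκ` in the block-shift error, dominated convergence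
  replaces «eventually all of `d(m+j)`, `|j| ≤ R`, are small»).
* PS_LJ `ProfileSlavingLJ Λ η` [the target]: two clean separated Nash stacked layered LJ configurations over the SAME in-plane periods `a, b`
  whose offset profiles stay at bounded distance and whose increments agree to within `η` differ by a TRANSLATION.

Non-vacuity remarks: `TubeMonotone` is an `∃ λ κ` statement per equilibrium (no hidden uniformity); its monotonicity clause is contentful
whenever the tube has more than one point (`η > 0`); `NashBalance`/`ProfileSlavingLJ` quantify over genuine LJ objects — their hypotheses are
satisfiable only by actual clean LJ equilibria (existence of such is NOT claimed here).  Def-bearing (7 defs, all non-Prop except the four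
pieces); no sorry; imports the landed `…ChartedPlanarOrderDoorLayered` only.
-/

noncomputable section

open MeasureTheory Set Metric
open scoped RealInnerProductSpace
open Summit.AtomisticToContinuum.Crystallization.Theorems.ChartedPlanarOrderRigidityDoor
open Summit.AtomisticToContinuum.Crystallization.Theorems.ChartedPlanarOrderDensityDichotomy
open Summit.AtomisticToContinuum.Crystallization.Theorems.ChartedPlanarOrderMesoCut
open Summit.AtomisticToContinuum.Crystallization.Theorems.ChartedPlanarOrderDoorLayered (Layered)

namespace Summit.AtomisticToContinuum.Crystallization.Theorems.ChartedPlanarOrderProfileSlavingLJ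

/-! ## 1. The LJ layer dictionary -/

/-- LJ pair force ON the atom at relative position `x` (from an atom at the origin): `−∇ₓ V_LJ(‖x‖) = (‖x‖⁻¹⁴ − ‖x‖⁻⁸) x` for
`V_LJ(r) = r⁻¹²/12 − r⁻⁶/6`. -/
def pairForce (x : E3) : E3 := (‖x‖⁻¹ ^ 14 - ‖x‖⁻¹ ^ 8) • x

/-- force on one atom at offset `v` from a full in-plane layer `ℤa + ℤb` through the origin (2D lattice sum; junk `0` if divergent). -/
def layerForce (a b v : E3) : E3 := ∑' ij : ℤ × ℤ, pairForce (v + ((ij.1 : ℝ) • a + (ij.2 : ℝ) • b))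

/-- the increment profile of an offset profile `w`. -/
def incr (w : ℤ → E3) (k : ℤ) : E3 := w k - w (k - 1)

/-- the offset of layer `l` over layer `k` recovered from an increment profile: `Σ_{i ∈ (k, l]} h i`. -/
def offsetOf (h : ℤ → E3) (k l : ℤ) : E3 := ∑ i ∈ Finset.Ioc k l, h i

/-- the layer pairs `(k, l)` straddling gap `m`: `k < m ≤ l`. -/
def Straddle (m : ℤ) : Type := {p : ℤ × ℤ // p.1 < m ∧ m ≤ p.2}

/-- **transmitted stress across gap `m`**: total LJ force per unit cell exerted by the upper half `{l ≥ m}` on the lower half `{k < m}`,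
as a map on increment profiles (junk `0` if the straddling sum diverges). -/
def gapStress (a b : E3) (m : ℤ) (h : ℤ → E3) : E3 :=
  ∑' p : Straddle m, layerForce a b (-(offsetOf h p.1.1 p.1.2))

/-- a HEIGHT-SORTED layered representation: a common normal `n ⊥ a, b` along which the offsets strictly increase. -/
def IsStacked (a b : E3) (w : ℤ → E3) : Prop :=
  ∃ n : E3, ⟪n, a⟫ = 0 ∧ ⟪n, b⟫ = 0 ∧ ∀ m : ℤ, 0 < ⟪n, w (m + 1) - w m⟫

/-- the `η`-tube around the increment profile of `w` (the windows of the abstract kernel). -/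
def tube (w : ℤ → E3) (η : ℝ) (k : ℤ) : Set E3 := closedBall (incr w k) η

/-- `offsetOf (incr w) k l = w l − w k` for `k ≤ l` (telescoping): the dictionary reads the physical relative offsets. -/
theorem offsetOf_incr (w : ℤ → E3) {k l : ℤ} (hkl : k ≤ l) : offsetOf (incr w) k l = w l - w k := by
  obtain ⟨n, rfl⟩ : ∃ n : ℕ, l = k + n := ⟨(l - k).toNat, by rw [Int.toNat_of_nonneg (sub_nonneg.mpr hkl)]; ring⟩
  unfold offsetOf incr
  clear hkl
  induction n with
  | zero => simp
  | succ n ih =>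
    rw [show k + ((n + 1 : ℕ) : ℤ) = (k + n) + 1 by push_cast; ring,
      ← Finset.insert_Ioc_right_eq_Ioc_add_one (by omega : k ≤ k + n), Finset.sum_insert (by simp), ih]
    rw [show k + (n : ℤ) + 1 - 1 = k + n by ring]
    abel

/-! ## 2. The pieces (Props) -/

/-- **D1 «NashBalance Λ»** (S/M · TRUE?): a clean `δ`-separated single-site-Nash stacked layered LJ configuration with in-plane periods of norm
`≤ Λ` transmits the same stress across every gap. -/
def NashBalance (Λ : ℝ) : Prop :=
  ∀ δ : ℝ, 0 < δ → ∀ (a b : E3) (w : ℤ → E3), ‖a‖ ≤ Λ → ‖b‖ ≤ Λ →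
    IsSep δ (Layered a b w) → IsClean (μS (Layered a b w)) → IsNash (μS (Layered a b w)) → IsStacked a b w →
    ∃ σ : E3, ∀ m : ℤ, gapStress a b m (incr w) = σ

/-- **W «TubeMonotone Λ η»** (M/L · INSTRUMENTABLE, census TAG 138′): around every clean separated Nash stacked layered LJ configuration the
gap-stress map is `λ`-strongly monotone in the own increment and `ℓ¹`-Lipschitz (summable weights `κ` with finite first moment,
`Σ_j κ_j − κ_0 < λ`) on the `η`-tube of its increment profile; `λ, κ` may depend on the configuration. -/
def TubeMonotone (Λ η : ℝ) : Prop :=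
  ∀ δ : ℝ, 0 < δ → ∀ (a b : E3) (w : ℤ → E3), ‖a‖ ≤ Λ → ‖b‖ ≤ Λ →
    IsSep δ (Layered a b w) → IsClean (μS (Layered a b w)) → IsNash (μS (Layered a b w)) → IsStacked a b w →
    ∃ (lam : ℝ) (κ : ℤ → ℝ), (∀ j, 0 ≤ κ j) ∧ Summable κ ∧ Summable (fun j : ℤ => |(j : ℝ)| * κ j) ∧ (∑' j, κ j) - κ 0 < lam ∧
      (∀ m : ℤ, ∀ h : ℤ → E3, (∀ k, h k ∈ tube w η k) → ∀ b' ∈ tube w η m,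
        lam * ‖h m - b'‖ ^ 2 ≤ ⟪gapStress a b m h - gapStress a b m (Function.update h m b'), h m - b'⟫) ∧
      (∀ m : ℤ, ∀ h h' : ℤ → E3, (∀ k, h k ∈ tube w η k) → (∀ k, h' k ∈ tube w η k) →
        ‖gapStress a b m h - gapStress a b m h'‖ ≤ ∑' j : ℤ, κ j * ‖h (m + j) - h' (m + j)‖)

/-- **E1 «SlavingKernelL1»** (S · ATTACKABLE; finite-range case = pub `LayerChainTail.slaving_translation`): the abstract slaving kernel with
`ℓ¹` couplings of finite first moment — two window-valued increment profiles with constant transmitted stress each and offsets at bounded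
distance differ by a translation of the offsets. -/
def SlavingKernelL1 : Prop :=
  ∀ (Φ : ℤ → (ℤ → E3) → E3) (W : ℤ → Set E3) (lam : ℝ) (κ : ℤ → ℝ),
    (∀ j, 0 ≤ κ j) → Summable κ → Summable (fun j : ℤ => |(j : ℝ)| * κ j) → (∑' j, κ j) - κ 0 < lam →
    (∀ m : ℤ, ∀ h : ℤ → E3, (∀ k, h k ∈ W k) → ∀ b' ∈ W m,
      lam * ‖h m - b'‖ ^ 2 ≤ ⟪Φ m h - Φ m (Function.update h m b'), h m - b'⟫) →
    (∀ m : ℤ, ∀ h h' : ℤ → E3, (∀ k, h k ∈ W k) → (∀ k, h' k ∈ W k) →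
      ‖Φ m h - Φ m h'‖ ≤ ∑' j : ℤ, κ j * ‖h (m + j) - h' (m + j)‖) →
    ∀ w w' : ℤ → E3, (∀ k, w k - w (k - 1) ∈ W k) → (∀ k, w' k - w' (k - 1) ∈ W k) →
    ∀ σ σ' : E3, (∀ m, Φ m (fun k => w k - w (k - 1)) = σ) → (∀ m, Φ m (fun k => w' k - w' (k - 1)) = σ') →
    ∀ D : ℝ, (∀ m, ‖w m - w' m‖ ≤ D) → ∃ c : E3, ∀ m, w' m = w m + c

/-- **PS_LJ «ProfileSlavingLJ Λ η»** (the target of the column): two clean separated Nash stacked layered LJ configurations over the SAME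
in-plane periods `a, b` (norms `≤ Λ`) whose offset profiles stay at bounded distance and whose increments agree to within `η` differ by a
translation. -/
def ProfileSlavingLJ (Λ η : ℝ) : Prop :=
  ∀ δ : ℝ, 0 < δ → ∀ (a b : E3) (w w' : ℤ → E3), ‖a‖ ≤ Λ → ‖b‖ ≤ Λ →
    IsSep δ (Layered a b w) → IsClean (μS (Layered a b w)) → IsNash (μS (Layered a b w)) → IsStacked a b w →
    IsSep δ (Layered a b w') → IsClean (μS (Layered a b w')) → IsNash (μS (Layered a b w')) → IsStacked a b w' →
    (∃ D : ℝ, ∀ m, ‖w' m - w m‖ ≤ D) → (∀ m, ‖(w' m - w' (m - 1)) - (w m - w (m - 1))‖ ≤ η) →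
    ∃ c : E3, ∀ m, w' m = w m + c

/-! ## 3. The assembly (PROVED): PS_LJ ⟸ E1 ∧ D1 ∧ W -/

/-- **PS_LJ from the pieces.**  The kernel's windows are the `η`-tube around the first configuration's increments; both stresses are constant by
D1; the second profile lies in the tube by the PS hypothesis; W supplies `λ, κ` for that tube. -/
theorem profileSlavingLJ_of {Λ η : ℝ} (hK : SlavingKernelL1) (hB : NashBalance Λ) (hW : TubeMonotone Λ η) : ProfileSlavingLJ Λ η := by
  intro δ hδ a b w w' ha hb hs hc hn hst hs' hc' hn' hst' hD hη
  obtain ⟨D, hD⟩ := hD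
  obtain ⟨lam, κ, hκ0, hκs, hκ1, hdom, hmono, hlip⟩ := hW δ hδ a b w ha hb hs hc hn hst
  obtain ⟨σ, hσ⟩ := hB δ hδ a b w ha hb hs hc hn hst
  obtain ⟨σ', hσ'⟩ := hB δ hδ a b w' ha hb hs' hc' hn' hst'
  have hη0 : 0 ≤ η := le_trans (norm_nonneg _) (hη 0)
  refine hK (gapStress a b) (tube w η) lam κ hκ0 hκs hκ1 hdom hmono hlip w w' (fun k => mem_closedBall_self hη0)
    (fun k => ?_) σ σ' hσ hσ' D (fun m => by rw [norm_sub_rev]; exact hD m)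
  show w' k - w' (k - 1) ∈ closedBall (w k - w (k - 1)) η
  rw [mem_closedBall, dist_eq_norm]
  exact hη k

/-- equal increment profiles ⇒ the offsets differ by the constant `w' 0 − w 0` (chaining through `ℤ`). -/
theorem sub_eq_sub_zero_of_incr_eq {w w' : ℤ → E3} (h : ∀ m : ℤ, incr w' m = incr w m) :
    ∀ m : ℤ, w' m - w m = w' 0 - w 0 := by
  have step : ∀ m : ℤ, w' m - w m = w' (m - 1) - w (m - 1) := fun m => by
    have := h m
    simp only [incr] at this
    rw [sub_eq_sub_iff_add_eq_add] at this ⊢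
    rw [add_comm (w' (m - 1)), ← this, add_comm]
  intro m
  induction m using Int.induction_on with
  | zero => rfl
  | succ n ih =>
    have := step ((n : ℤ) + 1)
    rw [add_sub_cancel_right] at this
    rw [this, ih]
  | pred n ih =>
    have := step (-(n : ℤ))
    rw [← ih, this]

/-- the conclusion shape of PS_LJ is exactly «same increment profiles» (sanity: nothing weaker, nothing stronger). -/
theorem translation_iff_incr_eq (w w' : ℤ → E3) :
    (∃ c : E3, ∀ m, w' m = w m + c) ↔ ∀ m, incr w' m = incr w m := by
  constructor
  · rintro ⟨c, hc⟩ m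
    simp only [incr, hc m, hc (m - 1)]
    abel
  · intro h
    exact ⟨w' 0 - w 0, fun m => by rw [← sub_eq_sub_zero_of_incr_eq h m]; abel⟩

end Summit.AtomisticToContinuum.Crystallization.Theorems.ChartedPlanarOrderProfileSlavingLJ

end
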